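import Literature.Probability.Percolation.BondInterfaceFaceDomainULC
import HarnessLib

/-!
# Face kernel (K1), rotation of boundary cycles and the two colour changes

Route `CardyComplexCone` (sub-problem `CriticalPhenomena/CardyFormulaZ2`), crux
`Summit.CriticalPhenomena.CardyFormulaZ2.Theses.CardyComplexCone.ParafermionToSLESixFamilies`
(item stmt-CriticalPhenomena-11389), line `face-kernel-k1` (lead c4), helpers of the assembly stub
`stub_percFaceK1_of`.

* `bwalk_bwalk`, `bperiod_eq_of_bwalk_eq`, `W_bloop_eq_of_bwalk_eq` — the left-hand boundary walk
  from a dart of the orbit of `d₀` is the shifted walk; the periods agree and the winding numbers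
  of the two full-period closed walks agree (a cyclic shift of the sum).
* `exists_bwalk_eq_startCorner` — **two colours force the start corner**: if a boundary walk of
  admissible data visits a site on the discrete arc of `A` and a site off it, then it has two
  colour changes, i.e. two distinct `A`–`B` edges among its darts; as there are exactly two
  `A`–`B` edges, one of them is `e_a`, so the walk passes through the start corner.
* `bcycle_W_eq_of_colours` — hence its full-period winding numbers are those of the boundary
  cycle `bcycle` from `e_a` (whose polygon bounds the face domain).
-/

noncomputable section

open Filter Set Metric
open Literature.Probability Literature.Probability.LatticeModels Literature.Probability.Percolation
open Literature.Probability.LatticeModels.DiscreteDobrushin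
open Literature.Probability.RandomPlanarGeometry

namespace Summit.CriticalPhenomena.CardyFormulaZ2.Cruxes.ParafermionToSLESixFamilies.FaceKernel

variable {E : DiscreteDobrushin}

/-! ### Rotation of the boundary walk -/

/-- The walk from the dart at position `t₀` is the shifted walk. -/
theorem bwalk_bwalk (d₀ : Site 2 × Fin 4) (t₀ n : ℕ) :
    E.bwalk (E.bwalk d₀ t₀) n = E.bwalk d₀ (t₀ + n) := by
  induction n with
  | zero => rfl
  | succ n ih =>
    show E.bsucc (E.bwalk (E.bwalk d₀ t₀) n) = E.bsucc (E.bwalk d₀ (t₀ + n))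
    rw [ih]

/-- The period of the walk from a dart of the orbit is at most the period of the orbit. -/
theorem bperiod_le_of_bwalk_eq (hE : E.IsZdAdmissible) {d₀ d₁ : Site 2 × Fin 4}
    (h₀ : E.IsOutEdge d₀.1 d₀.2) (h₁ : E.IsOutEdge d₁.1 d₁.2) {t₀ : ℕ} (h : E.bwalk d₀ t₀ = d₁) :
    bperiod hE h₁ ≤ bperiod hE h₀ := by
  have hret : E.bwalk d₁ (bperiod hE h₀) = E.bwalk d₁ 0 := by
    rw [bwalk_zero, ← h, bwalk_bwalk, bwalk_add_bperiod]
  rw [bwalk_eq_iff_mod_eq hE h₁, Nat.zero_mod] at hret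
  exact Nat.le_of_dvd (bperiod_pos hE h₀) (Nat.dvd_of_mod_eq_zero hret)

/-- **The periods of the walks from two darts of one orbit agree.** -/
theorem bperiod_eq_of_bwalk_eq (hE : E.IsZdAdmissible) {d₀ d₁ : Site 2 × Fin 4}
    (h₀ : E.IsOutEdge d₀.1 d₀.2) (h₁ : E.IsOutEdge d₁.1 d₁.2) {t₀ : ℕ} (h : E.bwalk d₀ t₀ = d₁) :
    bperiod hE h₁ = bperiod hE h₀ := by
  have h' : E.bwalk d₁ (bperiod hE h₀ * (t₀ + 1) - t₀) = d₀ := by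
    have hP := bperiod_pos hE h₀
    have hle : t₀ ≤ bperiod hE h₀ * (t₀ + 1) := by nlinarith
    rw [← h, bwalk_bwalk, Nat.add_sub_cancel' hle, mul_comm,
      show (t₀ + 1) * bperiod hE h₀ = 0 + (t₀ + 1) * bperiod hE h₀ by rw [zero_add],
      bwalk_add_mul_bperiod hE h₀, bwalk_zero]
  exact le_antisymm (bperiod_le_of_bwalk_eq hE h₀ h₁ h) (bperiod_le_of_bwalk_eq hE h₁ h₀ h')

/-- A cyclic shift does not change the sum over a period of a periodic sequence. -/
theorem sum_range_add_of_periodic {g : ℕ → ℤ} {P : ℕ} (hg : ∀ n, g (n + P) = g n) (t : ℕ) :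
    ∑ j ∈ Finset.range P, g (j + t) = ∑ j ∈ Finset.range P, g j := by
  induction t with
  | zero => simp
  | succ t ih =>
    have h1 : ∑ j ∈ Finset.range P, g (j + 1 + t) = ∑ j ∈ Finset.range P, g (j + t) :=
      sum_range_succ_of_periodic (g := fun j => g (j + t)) (by simpa [add_comm] using hg t)
    simpa [add_assoc, add_comm, add_left_comm] using h1.trans ih

/-- **The full-period winding numbers from two darts of one orbit agree** (the defining sum of
`ClosedWalk.W` is shifted cyclically). -/
theorem W_bloop_eq_of_bwalk_eq (hE : E.IsZdAdmissible) {d₀ d₁ : Site 2 × Fin 4}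
    (h₀ : E.IsOutEdge d₀.1 d₀.2) (h₁ : E.IsOutEdge d₁.1 d₁.2) {t₀ : ℕ} (h : E.bwalk d₀ t₀ = d₁)
    {hm₁ : 0 < bperiod hE h₁} {hcl₁ : (E.bwalk d₁ (0 + bperiod hE h₁)).1 = (E.bwalk d₁ 0).1}
    {hm₀ : 0 < bperiod hE h₀} {hcl₀ : (E.bwalk d₀ (0 + bperiod hE h₀)).1 = (E.bwalk d₀ 0).1}
    (f : ℤ × ℤ) :
    (bloop 0 (bperiod hE h₁) hm₁ hcl₁).W f = (bloop 0 (bperiod hE h₀) hm₀ hcl₀).W f := by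
  subst h
  have hP : bperiod hE h₁ = bperiod hE h₀ := bperiod_eq_of_bwalk_eq hE h₀ h₁ rfl
  have hvP : ∀ n, toZ2 (E.bwalk d₀ (n + bperiod hE h₀)).1 = toZ2 (E.bwalk d₀ n).1 := fun n => by
    rw [bwalk_add_bperiod]
  have hv₀ : ∀ j, (bloop 0 (bperiod hE h₀) hm₀ hcl₀).v j = toZ2 (E.bwalk d₀ j).1 := fun j => by
    rw [bloop_v, zero_add, bwalk_mod_bperiod hE h₀]
  have hv₁ : ∀ j, (bloop 0 (bperiod hE h₁) hm₁ hcl₁).v j = toZ2 (E.bwalk d₀ (j + t₀)).1 := by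
    intro j
    rw [bloop_v, zero_add, bwalk_bwalk]
    have : E.bwalk d₀ (t₀ + j % bperiod hE h₁) = E.bwalk d₀ (j + t₀) := by
      rw [bwalk_eq_iff_mod_eq hE h₀, hP, Nat.add_mod, Nat.mod_mod, ← Nat.add_mod, add_comm]
    rw [this]
  unfold ClosedWalk.W
  simp only [hv₀, hv₁]
  rw [hP]
  have key := sum_range_add_of_periodic (P := bperiod hE h₀)
    (g := fun j => indZ (f.1 < (toZ2 (E.bwalk d₀ j).1).1) *
      (indZ (f.2 < (toZ2 (E.bwalk d₀ (j + 1)).1).2) - indZ (f.2 < (toZ2 (E.bwalk d₀ j).1).2)))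
    (fun n => by simp only [add_right_comm n (bperiod hE h₀) 1, hvP]) t₀
  convert key using 3
  · simp [add_right_comm _ t₀ 1]
    rfl

/-! ### Two colours force the start corner -/

/-- The vertices of a boundary walk are boundary sites. -/
theorem bwalk_fst_mem_zdBoundary {d₀ : Site 2 × Fin 4} (h₀ : E.IsOutEdge d₀.1 d₀.2) (n : ℕ) :
    (E.bwalk d₀ n).1 ∈ E.zdBoundary :=
  (isOutEdge_bwalk h₀ n).isFaceBoundaryEdge.mem_zdBoundary.1

/-- For admissible data, a vertex of a boundary walk off the discrete arc of `A` is on the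
discrete arc of `B`. -/
theorem bwalk_fst_mem_zdArcB (hE : E.IsZdAdmissible) {d₀ : Site 2 × Fin 4}
    (h₀ : E.IsOutEdge d₀.1 d₀.2) {n : ℕ} (hn : (E.bwalk d₀ n).1 ∉ E.zdArcA) :
    (E.bwalk d₀ n).1 ∈ E.zdArcB :=
  (hE.zdBoundary_subset (bwalk_fst_mem_zdBoundary h₀ n)).resolve_left hn

/-- A dart of a boundary walk from a site on the arc of `A` to a site off it carries an `A`–`B`
edge. -/
theorem cSrc_bwalk_mem_zdABEdges_of_mem (hE : E.IsZdAdmissible) {d₀ : Site 2 × Fin 4}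
    (h₀ : E.IsOutEdge d₀.1 d₀.2) {n : ℕ} (hA : (E.bwalk d₀ n).1 ∈ E.zdArcA)
    (hB : (E.bwalk d₀ (n + 1)).1 ∉ E.zdArcA) : cSrc (E.bwalk d₀ n) ∈ E.zdABEdges := by
  have hB' := bwalk_fst_mem_zdArcB hE h₀ hB
  rw [bwalk_fst_succ] at hB'
  exact cSrc_mem_zdABEdges hA hB' (Or.inl (isOutEdge_bwalk h₀ n))

/-- A dart of a boundary walk from a site off the arc of `A` to a site on it carries an `A`–`B`
edge (read from its `A`-end, where it is targeted). -/
theorem cSrc_bwalk_mem_zdABEdges_of_not_mem (hE : E.IsZdAdmissible) {d₀ : Site 2 × Fin 4}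
    (h₀ : E.IsOutEdge d₀.1 d₀.2) {n : ℕ} (hB : (E.bwalk d₀ n).1 ∉ E.zdArcA)
    (hA : (E.bwalk d₀ (n + 1)).1 ∈ E.zdArcA) : cSrc (E.bwalk d₀ n) ∈ E.zdABEdges := by
  have hB' := bwalk_fst_mem_zdArcB hE h₀ hB
  set p := E.bwalk d₀ n with hp
  rw [bwalk_fst_succ] at hA
  have hin : E.IsInEdge (p.1 + cornerUnit p.2) (p.2 + 2) :=
    (isOutEdge_iff_isInEdge _ _).1 (isOutEdge_bwalk h₀ n)
  have hB'' : p.1 + cornerUnit p.2 + cornerUnit (p.2 + 2) ∈ E.zdArcB := by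
    rw [add_cornerUnit_add_cornerUnit_add_two]; exact hB'
  have key := cSrc_mem_zdABEdges hA hB'' (Or.inr hin)
  rw [add_cornerUnit_add_cornerUnit_add_two] at key
  rw [cSrc, Sym2.eq_swap]
  exact key

/-- **Two colours force the start corner.** If a boundary walk of admissible data visits a site
on the discrete arc of `A` and a site off it, it passes through the start corner `e_a`: along
the walk there is a step leaving the arc of `A` and a step entering it, carrying two distinct
`A`–`B` edges (`cSrc` is injective on face-boundary darts), and of the exactly two `A`–`B` edges
one is `e_a`. -/
theorem exists_bwalk_eq_startCorner (hE : E.IsZdAdmissible) {d₀ : Site 2 × Fin 4}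
    (h₀ : E.IsOutEdge d₀.1 d₀.2) {s t : ℕ} (hs : (E.bwalk d₀ s).1 ∈ E.zdArcA)
    (ht : (E.bwalk d₀ t).1 ∉ E.zdArcA) : ∃ t₀, E.bwalk d₀ t₀ = startCorner hE := by
  classical
  set P := bperiod hE h₀ with hPdef
  -- a step leaving the arc of `A`, after `s`
  have hex₁ : ∃ n, s ≤ n ∧ (E.bwalk d₀ n).1 ∉ E.zdArcA :=
    ⟨t + s * P, by nlinarith [bperiod_pos hE h₀], by rwa [bwalk_add_mul_bperiod hE h₀]⟩
  set n₁ := Nat.find hex₁ with hn₁def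
  obtain ⟨hsn₁, hn₁⟩ : s ≤ n₁ ∧ (E.bwalk d₀ n₁).1 ∉ E.zdArcA := Nat.find_spec hex₁
  have hn₁s : n₁ ≠ s := fun h => hn₁ (h ▸ hs)
  have hn₁pos : 0 < n₁ := by omega
  have hprev₁ : (E.bwalk d₀ (n₁ - 1)).1 ∈ E.zdArcA := by
    by_contra h
    exact Nat.find_min hex₁ (m := n₁ - 1) (by omega) ⟨by omega, h⟩
  have he₁ : cSrc (E.bwalk d₀ (n₁ - 1)) ∈ E.zdABEdges :=
    cSrc_bwalk_mem_zdABEdges_of_mem hE h₀ hprev₁ (by rw [Nat.sub_add_cancel hn₁pos]; exact hn₁)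
  -- a step entering the arc of `A`, after `n₁`
  have hex₂ : ∃ n, n₁ ≤ n ∧ (E.bwalk d₀ n).1 ∈ E.zdArcA :=
    ⟨s + n₁ * P, by nlinarith [bperiod_pos hE h₀], by rwa [bwalk_add_mul_bperiod hE h₀]⟩
  set n₂ := Nat.find hex₂ with hn₂def
  obtain ⟨hsn₂, hn₂⟩ : n₁ ≤ n₂ ∧ (E.bwalk d₀ n₂).1 ∈ E.zdArcA := Nat.find_spec hex₂
  have hn₂n₁ : n₂ ≠ n₁ := fun h => hn₁ (h ▸ hn₂)
  have hn₂pos : n₁ < n₂ := by omega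
  have hprev₂ : (E.bwalk d₀ (n₂ - 1)).1 ∉ E.zdArcA := by
    intro h
    exact Nat.find_min hex₂ (m := n₂ - 1) (by omega) ⟨by omega, h⟩
  have he₂ : cSrc (E.bwalk d₀ (n₂ - 1)) ∈ E.zdABEdges :=
    cSrc_bwalk_mem_zdABEdges_of_not_mem hE h₀ hprev₂
      (by rw [Nat.sub_add_cancel (by omega : 1 ≤ n₂)]; exact hn₂)
  -- the two edges are distinct
  have hne : cSrc (E.bwalk d₀ (n₁ - 1)) ≠ cSrc (E.bwalk d₀ (n₂ - 1)) := by
    intro h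
    have := eq_of_isOutEdge_of_cSrc_eq (isOutEdge_bwalk h₀ _) (isOutEdge_bwalk h₀ _) h
    exact hprev₂ (this ▸ hprev₁)
  -- so one of them is `e_a`
  by_cases h₁ : cSrc (E.bwalk d₀ (n₁ - 1)) = cSrc (startCorner hE)
  · exact ⟨n₁ - 1, eq_of_isOutEdge_of_cSrc_eq (isOutEdge_bwalk h₀ _) (isOutEdge_startCorner hE) h₁⟩
  · by_cases h₂ : cSrc (E.bwalk d₀ (n₂ - 1)) = cSrc (startCorner hE)
    · exact ⟨n₂ - 1, eq_of_isOutEdge_of_cSrc_eq (isOutEdge_bwalk h₀ _) (isOutEdge_startCorner hE) h₂⟩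
    · exact absurd (eq_of_mem_zdABEdges_of_ne hE he₁ he₂ h₁ h₂) hne

/-- **The winding numbers of a two-coloured boundary walk are those of the boundary cycle from
`e_a`.** -/
theorem bcycle_W_eq_of_colours :
    ∀ {E : DiscreteDobrushin} (hE : E.IsZdAdmissible) {d₀ : Site 2 × Fin 4}
      (h₀ : E.IsOutEdge d₀.1 d₀.2) {s t : ℕ}, (E.bwalk d₀ s).1 ∈ E.zdArcA →
      (E.bwalk d₀ t).1 ∉ E.zdArcA →
      ∀ {hm : 0 < bperiod hE h₀} {hcl : (E.bwalk d₀ (0 + bperiod hE h₀)).1 = (E.bwalk d₀ 0).1}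
        (f : ℤ × ℤ), (bcycle hE).W f = (bloop 0 (bperiod hE h₀) hm hcl).W f := by
  intro E hE d₀ h₀ s t hs ht hm hcl f
  obtain ⟨t₀, ht₀⟩ := exists_bwalk_eq_startCorner hE h₀ hs ht
  exact W_bloop_eq_of_bwalk_eq hE h₀ (isOutEdge_startCorner hE) ht₀ f

end Summit.CriticalPhenomena.CardyFormulaZ2.Cruxes.ParafermionToSLESixFamilies.FaceKernel

end
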